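import Literature.Topology.FourManifolds.OpenSlabSimplyConnected
import Mathlib.AlgebraicTopology.FundamentalGroupoid.InducedMaps

/-!
# The open slab around the critical values is a deformation retract of `W`: the homotopy
# equivalence, and injectivity of fundamental groups (Milnor 1965, Thm. 3.4 / Cor. 3.5)

Topic `Literature/Topology/FourManifolds` (infrastructure for the fact seat
`provefact-Literature.Geometry.Riemannian.LawsonMichelsohn1984_surrounding`: Wall's form of the
trading of `1`-handles under `π₁(W, V) = 0` needs the *injectivity* of `π₁(V₂₊) → π₁(W)`, where
Milnor's Thm. 8.1 uses `π₁(V₂₊) = π₁(W) = 1`).  Everything here is **proved**.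

`OpenSlabSimplyConnected.lean` proves that the open slab `U = g⁻¹(ℓ₀, ℓ₁)` around all
critical values of a Morse function on a cobordism is simply connected when `W` is, by
constructing — inside the proof — a homotopy equivalence `U ≃ₕ W` whose map is the inclusion
(`W` deforms into `U` through maps keeping `U` inside `U`: off the boundary along the flow-out
of a boundary-defining function, Cor. 3.5, then along the unit-speed flow of `g` across the two
critical-point-free end bands, Thm. 3.4).  This file exposes that homotopy equivalence and
draws the consequence for fundamental groups:

* `Cobordism.exists_homotopyEquiv_openSlab` — the homotopy equivalence `e : U ≃ₕ W` with
  `e.toFun = Subtype.val` (the proof of `Cobordism.isSimplyConnected_openSlab`, verbatim, with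
  its last line changed and the hypothesis "`W` simply connected" weakened to "`W` nonempty");
* `Cobordism.homotopic_of_homotopic_map_val_openSlab` — **`π₁(U) → π₁(W)` is injective**:
  two paths of `U` whose images in `W` are homotopic rel end-points are homotopic rel
  end-points in `U` (the induced functor of fundamental groupoids is an equivalence, Mathlib's
  `FundamentalGroupoidFunctor.equivOfHomotopyEquiv`, hence faithful);
(The tree's `Cobordism.isSimplyConnected_openSlab` is `e.simplyConnectedSpace` for this `e`.)

## References

* J. Milnor, *Lectures on the h-cobordism theorem*, Princeton (1965), Thm. 3.4 and Cor. 3.5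
  with their proofs (PDF pp. 12–13), used as on PDF p. 56. [MilnorHCobordism1965]
-/

open scoped Manifold ContDiff Topology unitInterval
open Set Function Filter Metric

noncomputable section

namespace Literature.Topology.FourManifolds

universe u

section Cobordism

variable {n : ℕ} {M N : Type u} [TopologicalSpace M] [ChartedSpace (EuclideanSpace ℝ (Fin n)) M]
  [TopologicalSpace N] [ChartedSpace (EuclideanSpace ℝ (Fin n)) N]

/-- **Milnor 1965, Thm. 3.4 / Cor. 3.5 at the ends: the open slab around the critical values
is a deformation retract of `W` — the homotopy equivalence.**  For a Morse function `g` on the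
cobordism `c` and `0 < ℓ₀ < ℓ₁ < 1` such that every critical point of `g` has its value in
`(ℓ₀, ℓ₁)`, and `W` nonempty, there is a homotopy equivalence `e : g⁻¹(ℓ₀, ℓ₁) ≃ₕ W` whose
map is the inclusion.  (Proof of `Cobordism.isSimplyConnected_openSlab`,
`OpenSlabSimplyConnected.lean`, with the homotopy equivalence returned instead of consumed.)
[cite: MilnorHCobordism1965, Thm. 3.4 and Cor. 3.5 with their proofs (PDF pp. 12–13)] -/
theorem Cobordism.exists_homotopyEquiv_openSlab {c : Cobordism n M N} {g : c.W → ℝ}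
    (hg : c.IsMorseFunction g) {ℓ₀ ℓ₁ : ℝ} (hℓ₀ : 0 < ℓ₀) (hℓ₀₁ : ℓ₀ < ℓ₁) (hℓ₁ : ℓ₁ < 1)
    (hcrit : ∀ z ∈ criticalSet (𝓡∂ (n + 1)) g, g z ∈ Ioo ℓ₀ ℓ₁) [Nonempty c.W] :
    ∃ e : ContinuousMap.HomotopyEquiv ↥(g ⁻¹' Ioo ℓ₀ ℓ₁) c.W, ∀ u, e.toFun u = (u : c.W) := by
  classical
  set U : Set c.W := g ⁻¹' Ioo ℓ₀ ℓ₁ with hUdef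
  have hgs : ContMDiff (𝓡∂ (n + 1)) 𝓘(ℝ, ℝ) ∞ g := hg.isMorse.contMDiff
  have hgd : MDifferentiable (𝓡∂ (n + 1)) 𝓘(ℝ, ℝ) g := hgs.mdifferentiable (by simp)
  have hgc : Continuous g := hgs.continuous
  obtain ⟨z₀⟩ := ‹Nonempty c.W›
  ----------------------------------------------------------------------------------------------
  -- Step 1: off the boundary
  ----------------------------------------------------------------------------------------------
  obtain ⟨D⟩ := c.nonempty_flowoutInput
  obtain ⟨Γ₀⟩ := D.nonempty_cover
  have hfc : Continuous D.f := D.f_smooth.continuous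
  -- interior points and the values of `g`
  have hint_of_pos : ∀ z, 0 < D.f z → g z ∈ Ioo (0 : ℝ) 1 := by
    intro z hz
    refine hg.2.2.2.2 z (((𝓡∂ (n + 1)).isInteriorPoint_iff_not_isBoundaryPoint z).2 fun hb => ?_)
    exact hz.ne' ((D.f_eq_zero_iff z).2 hb)
  have hpos_of_int : ∀ z, g z ∈ Ioo (0 : ℝ) 1 → 0 < D.f z := by
    intro z hz
    refine lt_of_le_of_ne (D.f_nonneg z) fun h0 => ?_
    have hb : (𝓡∂ (n + 1)).IsBoundaryPoint z := (D.f_eq_zero_iff z).1 h0.symm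
    have hi := hg.isInteriorPoint_of_apply_mem_Ioo hz
    exact ((𝓡∂ (n + 1)).isInteriorPoint_iff_not_isBoundaryPoint z).1 hi hb
  -- a positive lower bound of `D.f` on the closed slab
  obtain ⟨d₀, hd₀, hd₀le⟩ : ∃ d₀ : ℝ, 0 < d₀ ∧ ∀ z, g z ∈ Icc ℓ₀ ℓ₁ → d₀ ≤ D.f z := by
    by_cases hne : (g ⁻¹' Icc ℓ₀ ℓ₁).Nonempty
    · have hKc : IsCompact (g ⁻¹' Icc ℓ₀ ℓ₁) := (isClosed_Icc.preimage hgc).isCompact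
      obtain ⟨z₁, hz₁, hmin⟩ := hKc.exists_isMinOn hne hfc.continuousOn
      refine ⟨D.f z₁, hpos_of_int z₁ ⟨hℓ₀.trans_le hz₁.1, hz₁.2.trans_lt hℓ₁⟩, fun z hz => ?_⟩
      exact (isMinOn_iff.1 hmin) z hz
    · exact ⟨1, one_pos, fun z hz => (hne ⟨z, hz⟩).elim⟩
  -- the cover with small height, and the first move
  let Γ : D.Cover :=
    { T := Γ₀.T
      f_lt := Γ₀.f_lt
      a := min Γ₀.a (d₀ / 2)
      a_pos := lt_min Γ₀.a_pos (by positivity)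
      a_le := fun y hy => (min_le_left _ _).trans (Γ₀.a_le y hy)
      cover := fun z hz => Γ₀.cover z (hz.trans (min_le_left _ _)) }
  have haU : ∀ z ∈ U, Γ.a < D.f z := fun z hz => by
    have h1 : Γ.a ≤ d₀ / 2 := min_le_right _ _
    have h2 := hd₀le z (Ioo_subset_Icc_self hz)
    linarith
  obtain ⟨R1, hR1_0, hR1_fix, hR1_1⟩ := Γ.exists_deformation
  have hapos : 0 < Γ.a := Γ.a_pos
  -- the values of `g` on `{a ≤ D.f}`
  have hK₁c : IsCompact {z : c.W | Γ.a ≤ D.f z} := (isClosed_le continuous_const hfc).isCompact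
  have hK₁ne : {z : c.W | Γ.a ≤ D.f z}.Nonempty := ⟨R1 (1, z₀), hR1_1 z₀⟩
  have hK₁g : ∀ z, Γ.a ≤ D.f z → g z ∈ Ioo (0 : ℝ) 1 := fun z hz => hint_of_pos z (hapos.trans_le hz)
  obtain ⟨zmin, hzmin, hmin⟩ := hK₁c.exists_isMinOn hK₁ne hgc.continuousOn
  obtain ⟨zmax, hzmax, hmax⟩ := hK₁c.exists_isMaxOn hK₁ne hgc.continuousOn
  set m₀ : ℝ := g zmin with hm₀
  set m₁ : ℝ := g zmax with hm₁
  have hm₀pos : 0 < m₀ := (hK₁g zmin hzmin).1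
  have hm₁lt : m₁ < 1 := (hK₁g zmax hzmax).2
  have hm₀le : ∀ z, Γ.a ≤ D.f z → m₀ ≤ g z := fun z hz => (isMinOn_iff.1 hmin) z hz
  have hm₁ge : ∀ z, Γ.a ≤ D.f z → g z ≤ m₁ := fun z hz => (isMaxOn_iff.1 hmax) z hz
  ----------------------------------------------------------------------------------------------
  -- Step 2: the levels `L ≤ L'` and the bands
  ----------------------------------------------------------------------------------------------
  obtain ⟨cmin, cmax, hc0, hc01, hc1, hcval⟩ : ∃ cmin cmax : ℝ, ℓ₀ < cmin ∧ cmin ≤ cmax ∧ cmax < ℓ₁ ∧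
      ∀ z ∈ criticalSet (𝓡∂ (n + 1)) g, cmin ≤ g z ∧ g z ≤ cmax := by
    have hfin : (criticalSet (𝓡∂ (n + 1)) g).Finite := IsMorse.finite_criticalSet_holds hg.isMorse
    by_cases hne : (criticalSet (𝓡∂ (n + 1)) g).Nonempty
    · set T : Finset ℝ := hfin.toFinset.image g with hT
      have hTne : T.Nonempty := by
        obtain ⟨z, hz⟩ := hne
        exact ⟨g z, Finset.mem_image.2 ⟨z, hfin.mem_toFinset.2 hz, rfl⟩⟩
      have hTmem : ∀ v ∈ T, v ∈ Ioo ℓ₀ ℓ₁ := by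
        intro v hv
        obtain ⟨z, hz, rfl⟩ := Finset.mem_image.1 hv
        exact hcrit z (hfin.mem_toFinset.1 hz)
      refine ⟨T.min' hTne, T.max' hTne, (hTmem _ (T.min'_mem hTne)).1, T.min'_le_max' hTne,
        (hTmem _ (T.max'_mem hTne)).2, fun z hz => ?_⟩
      have hv : g z ∈ T := Finset.mem_image.2 ⟨z, hfin.mem_toFinset.2 hz, rfl⟩
      exact ⟨T.min'_le _ hv, T.le_max' _ hv⟩
    · refine ⟨(ℓ₀ + ℓ₁) / 2, (ℓ₀ + ℓ₁) / 2, by linarith, le_rfl, by linarith, fun z hz => ?_⟩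
      exact (hne ⟨z, hz⟩).elim
  set L : ℝ := (ℓ₀ + cmin) / 2 with hL
  set L' : ℝ := (cmax + ℓ₁) / 2 with hL'
  set ε : ℝ := min ((cmin - L) / 2) ((L' - cmax) / 2) with hε
  have hε : 0 < ε := lt_min (by rw [hL]; linarith) (by rw [hL']; linarith)
  have hℓ₀L : ℓ₀ < L := by rw [hL]; linarith
  have hLL' : L ≤ L' := by rw [hL, hL']; linarith
  have hL'ℓ₁ : L' < ℓ₁ := by rw [hL']; linarith
  have hLε : L + ε < cmin := by
    have : ε ≤ (cmin - L) / 2 := min_le_left _ _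
    have : L < cmin := by rw [hL]; linarith
    linarith
  have hL'ε : cmax < L' - ε := by
    have : ε ≤ (L' - cmax) / 2 := min_le_right _ _
    have : cmax < L' := by rw [hL']; linarith
    linarith
  set p₀ : ℝ := min m₀ ℓ₀ / 2 with hp₀
  set p₁ : ℝ := (1 + max m₁ ℓ₁) / 2 with hp₁
  have hp₀pos : 0 < p₀ := by rw [hp₀]; positivity
  have hp₀m₀ : p₀ < m₀ := by
    have : min m₀ ℓ₀ ≤ m₀ := min_le_left _ _
    rw [hp₀]; linarith
  have hp₀ℓ₀ : p₀ < ℓ₀ := by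
    have : min m₀ ℓ₀ ≤ ℓ₀ := min_le_right _ _
    rw [hp₀]; linarith
  have hp₁lt : p₁ < 1 := by
    have : max m₁ ℓ₁ < 1 := max_lt hm₁lt hℓ₁
    rw [hp₁]; linarith
  have hm₁p₁ : m₁ < p₁ := by
    have : m₁ ≤ max m₁ ℓ₁ := le_max_left _ _
    rw [hp₁]; linarith
  have hℓ₁p₁ : ℓ₁ < p₁ := by
    have : ℓ₁ ≤ max m₁ ℓ₁ := le_max_right _ _
    rw [hp₁]; linarith
  -- the unit-speed field on the two bands
  set Cb : Set c.W := g ⁻¹' (Icc p₀ (L + ε) ∪ Icc (L' - ε) p₁) with hCb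
  have hCbc : IsClosed Cb := (isClosed_Icc.union isClosed_Icc).preimage hgc
  have hCbreg : ∀ z ∈ Cb, mfderiv (𝓡∂ (n + 1)) 𝓘(ℝ, ℝ) g z ≠ 0 := by
    intro z hz hcz
    obtain ⟨h1, h2⟩ := hcval z hcz
    rcases hz with hz | hz
    · exact absurd hz.2 (not_le.2 (by linarith))
    · exact absurd hz.1 (not_le.2 (by linarith))
  obtain ⟨ξh, hξh⟩ := exists_contMDiffSection_mlineDeriv_eq_one_on hgs hCbc hCbreg
  obtain ⟨θ, hθ⟩ := hg.exists_isSmoothFlow_slabField ξh.contMDiff hp₀pos hp₁lt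
  have hθc : Continuous θ := hθ.continuous
  have hYg : ∀ z, z ∈ Cb → g z ∈ Icc p₀ p₁ →
      mlineDeriv (𝓡∂ (n + 1)) g z (Cobordism.slabField g ξh p₀ p₁ z) = 1 := by
    intro z hzC hz
    rw [Cobordism.mlineDeriv_slabField, slabCutoff_eq_one hp₀pos hp₁lt hz, one_mul]
    exact hξh z hzC
  ----------------------------------------------------------------------------------------------
  -- Step 3: the clocks
  ----------------------------------------------------------------------------------------------
  have hclock_up : ∀ z, p₀ < g z → g z ≤ L → ∀ t ∈ Icc 0 (L - g z), g (θ (t, z)) = g z + t := by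
    intro z h1 h2 t ht
    have hderiv := fun s => hθ.hasDerivAt_comp hgd z s
    have hband : ∀ s, g (θ (s, z)) ∈ Ioo p₀ (L + ε) →
        mlineDeriv (𝓡∂ (n + 1)) g (θ (s, z)) (Cobordism.slabField g ξh p₀ p₁ (θ (s, z))) = 1 :=
      fun s hs => hYg _ (Or.inl ⟨hs.1.le, hs.2.le⟩) ⟨hs.1.le, by linarith [hs.2]⟩
    have key := UnitSpeed.eq_add_of_deriv_eq_one hderiv hband (t₀ := 0) (T := L - g z)
      (by rw [hθ.map_zero]; exact h1) (by rw [hθ.map_zero]; linarith)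
    have := key t ht
    rwa [zero_add, hθ.map_zero] at this
  have hclock_down : ∀ z, L' ≤ g z → g z < p₁ →
      ∀ t ∈ Icc 0 (g z - L'), g (θ (-t, z)) = g z - t := by
    intro z h1 h2 t ht
    have hθr := hθ.reverse
    have hgd' : MDifferentiable (𝓡∂ (n + 1)) 𝓘(ℝ, ℝ) fun y => 1 - g y := mdifferentiable_const_sub hgd 1
    have hderiv := fun s => hθr.hasDerivAt_comp hgd' z s
    have hband : ∀ s, (1 - g (θ (-s, z))) ∈ Ioo (1 - p₁) (1 - (L' - ε)) →
        mlineDeriv (𝓡∂ (n + 1)) (fun y => 1 - g y) (θ (-s, z))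
          ((-Cobordism.slabField g ξh p₀ p₁) (θ (-s, z))) = 1 := by
      intro s hs
      have hgs' : g (θ (-s, z)) ∈ Ioo (L' - ε) p₁ := ⟨by linarith [hs.2], by linarith [hs.1]⟩
      show mlineDeriv (𝓡∂ (n + 1)) (fun y => 1 - g y) (θ (-s, z))
        (-Cobordism.slabField g ξh p₀ p₁ (θ (-s, z))) = 1
      rw [mlineDeriv_const_sub (hgd _), mlineDeriv_neg, neg_neg]
      exact hYg _ (Or.inr ⟨hgs'.1.le, hgs'.2.le⟩) ⟨by linarith [hgs'.1], hgs'.2.le⟩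
    have key := UnitSpeed.eq_add_of_deriv_eq_one (g := fun s => 1 - g (θ (-s, z))) hderiv hband
      (t₀ := 0) (T := g z - L') (by simp only [neg_zero, hθ.map_zero]; linarith)
      (by simp only [neg_zero, hθ.map_zero]; linarith)
    have := key t ht
    simp only [zero_add, neg_zero, hθ.map_zero] at this
    linarith
  ----------------------------------------------------------------------------------------------
  -- Step 4: the three moves and their composite
  ----------------------------------------------------------------------------------------------
  set T₂ : c.W → ℝ := fun z => max 0 (L - g z) with hT₂
  set T₃ : c.W → ℝ := fun z => max 0 (g z - L') with hT₃
  have hT₂c : Continuous T₂ := continuous_const.max (continuous_const.sub hgc)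
  have hT₃c : Continuous T₃ := continuous_const.max (hgc.sub continuous_const)
  set R2 : unitInterval × c.W → c.W := fun p => θ ((p.1 : ℝ) * T₂ p.2, p.2) with hR2
  set R3 : unitInterval × c.W → c.W := fun p => θ (-((p.1 : ℝ) * T₃ p.2), p.2) with hR3
  have hR2c : Continuous R2 :=
    hθc.comp (((continuous_subtype_val.comp continuous_fst).mul (hT₂c.comp continuous_snd)).prodMk
      continuous_snd)
  have hR3c : Continuous R3 :=
    hθc.comp (((continuous_subtype_val.comp continuous_fst).mul (hT₃c.comp continuous_snd)).neg.prodMk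
      continuous_snd)
  -- the second move
  have hR2g : ∀ (s : unitInterval) (z), p₀ < g z → g z ≤ L →
      g (R2 (s, z)) = g z + (s : ℝ) * (L - g z) := by
    intro s z h1 h2
    have hT : T₂ z = L - g z := max_eq_right (by linarith)
    show g (θ ((s : ℝ) * T₂ z, z)) = _
    rw [hT]
    refine hclock_up z h1 h2 _ ⟨mul_nonneg s.2.1 (by linarith), ?_⟩
    exact mul_le_of_le_one_left (by linarith) s.2.2
  have hR2fix : ∀ (s : unitInterval) (z), L ≤ g z → R2 (s, z) = z := by
    intro s z h
    have hT : T₂ z = 0 := max_eq_left (by linarith)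
    show θ ((s : ℝ) * T₂ z, z) = z
    rw [hT, mul_zero, hθ.map_zero]
  have hR2U : ∀ (s : unitInterval), ∀ z ∈ U, R2 (s, z) ∈ U := by
    intro s z hz
    rcases le_or_gt (g z) L with h | h
    · have h1 := hR2g s z (hp₀ℓ₀.trans hz.1) h
      have h2 : 0 ≤ (s : ℝ) * (L - g z) := mul_nonneg s.2.1 (by linarith)
      have h3 : (s : ℝ) * (L - g z) ≤ L - g z := mul_le_of_le_one_left (by linarith) s.2.2
      show g (R2 (s, z)) ∈ Ioo ℓ₀ ℓ₁
      rw [h1]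
      exact ⟨by linarith [hz.1], by linarith⟩
    · rw [hR2fix s z h.le]; exact hz
  -- the third move
  have hR3g : ∀ (s : unitInterval) (z), L' ≤ g z → g z < p₁ →
      g (R3 (s, z)) = g z - (s : ℝ) * (g z - L') := by
    intro s z h1 h2
    have hT : T₃ z = g z - L' := max_eq_right (by linarith)
    show g (θ (-((s : ℝ) * T₃ z), z)) = _
    rw [hT]
    refine hclock_down z h1 h2 _ ⟨mul_nonneg s.2.1 (by linarith), ?_⟩
    exact mul_le_of_le_one_left (by linarith) s.2.2
  have hR3fix : ∀ (s : unitInterval) (z), g z ≤ L' → R3 (s, z) = z := by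
    intro s z h
    have hT : T₃ z = 0 := max_eq_left (by linarith)
    show θ (-((s : ℝ) * T₃ z), z) = z
    rw [hT, mul_zero, neg_zero, hθ.map_zero]
  have hR3U : ∀ (s : unitInterval), ∀ z ∈ U, R3 (s, z) ∈ U := by
    intro s z hz
    rcases lt_or_ge (g z) L' with h | h
    · rw [hR3fix s z h.le]; exact hz
    · have h1 := hR3g s z h (hz.2.trans hℓ₁p₁)
      have h2 : 0 ≤ (s : ℝ) * (g z - L') := mul_nonneg s.2.1 (by linarith)
      have h3 : (s : ℝ) * (g z - L') ≤ g z - L' := mul_le_of_le_one_left (by linarith) s.2.2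
      show g (R3 (s, z)) ∈ Ioo ℓ₀ ℓ₁
      rw [h1]
      exact ⟨by linarith, by linarith [hz.2]⟩
  -- the composite
  set Rt : unitInterval × c.W → c.W := fun p => R3 (p.1, R2 (p.1, R1 (p.1, p.2))) with hRt
  have hRtc : Continuous Rt := by
    refine hR3c.comp (continuous_fst.prodMk (hR2c.comp (continuous_fst.prodMk ?_)))
    exact R1.continuous.comp (continuous_fst.prodMk continuous_snd)
  have hRt0 : ∀ z, Rt (0, z) = z := by
    intro z
    show R3 (0, R2 (0, R1 (0, z))) = z
    rw [hR1_0 z]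
    have h2 : R2 (0, z) = z := by
      show θ (((0 : unitInterval) : ℝ) * T₂ z, z) = z
      rw [show ((0 : unitInterval) : ℝ) = 0 from rfl, zero_mul, hθ.map_zero]
    rw [h2]
    show θ (-(((0 : unitInterval) : ℝ) * T₃ z), z) = z
    rw [show ((0 : unitInterval) : ℝ) = 0 from rfl, zero_mul, neg_zero, hθ.map_zero]
  have hRtU : ∀ (s : unitInterval), ∀ z ∈ U, Rt (s, z) ∈ U := by
    intro s z hz
    show R3 (s, R2 (s, R1 (s, z))) ∈ U
    rw [hR1_fix s z (haU z hz).le]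
    exact hR3U s _ (hR2U s z hz)
  have hRt1 : ∀ z, Rt (1, z) ∈ U := by
    intro z
    set z₁ := R1 (1, z) with hz₁
    have hz₁K : Γ.a ≤ D.f z₁ := hR1_1 z
    have hg₁ : m₀ ≤ g z₁ ∧ g z₁ ≤ m₁ := ⟨hm₀le _ hz₁K, hm₁ge _ hz₁K⟩
    set z₂ := R2 (1, z₁) with hz₂
    have hg₂ : L ≤ g z₂ ∧ g z₂ ≤ max L m₁ := by
      rcases le_or_gt (g z₁) L with h | h
      · have h1 := hR2g 1 z₁ (hp₀m₀.trans_le hg₁.1) h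
        rw [show ((1 : unitInterval) : ℝ) = 1 from rfl, one_mul] at h1
        rw [hz₂, h1]
        exact ⟨le_of_eq (by ring), by linarith [le_max_left L m₁]⟩
      · rw [hz₂, hR2fix 1 z₁ h.le]
        exact ⟨h.le, hg₁.2.trans (le_max_right _ _)⟩
    have hg₂p₁ : g z₂ < p₁ := hg₂.2.trans_lt (max_lt (hLL'.trans_lt (hL'ℓ₁.trans hℓ₁p₁)) hm₁p₁)
    show R3 (1, z₂) ∈ U
    rcases lt_or_ge (g z₂) L' with h | h
    · rw [hR3fix 1 z₂ h.le]
      exact ⟨hℓ₀L.trans_le hg₂.1, h.trans hL'ℓ₁⟩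
    · have h1 := hR3g 1 z₂ h hg₂p₁
      rw [show ((1 : unitInterval) : ℝ) = 1 from rfl, one_mul] at h1
      show g (R3 (1, z₂)) ∈ Ioo ℓ₀ ℓ₁
      rw [h1]
      exact ⟨by linarith, by linarith⟩
  ----------------------------------------------------------------------------------------------
  -- Step 5: the inclusion of `U` is a homotopy equivalence
  ----------------------------------------------------------------------------------------------
  let RtC : C(unitInterval × c.W, c.W) := ⟨Rt, hRtc⟩
  let incl : C(↥U, c.W) := ⟨Subtype.val, continuous_subtype_val⟩
  let retr : C(c.W, ↥U) := ⟨fun z => ⟨Rt (1, z), hRt1 z⟩,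
    (hRtc.comp (Continuous.prodMk_right 1)).subtype_mk _⟩
  have HR : (incl.comp retr).Homotopic (ContinuousMap.id c.W) :=
    ⟨{ toFun := fun p => Rt (unitInterval.symm p.1, p.2)
       continuous_toFun :=
         hRtc.comp ((unitInterval.continuous_symm.comp continuous_fst).prodMk continuous_snd)
       map_zero_left := fun z => by
         show Rt (unitInterval.symm 0, z) = Rt (1, z)
         rw [unitInterval.symm_zero]
       map_one_left := fun z => by
         show Rt (unitInterval.symm 1, z) = z
         rw [unitInterval.symm_one]
         exact hRt0 z }⟩
  have HL : (retr.comp incl).Homotopic (ContinuousMap.id ↥U) :=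
    ⟨{ toFun := fun p => ⟨Rt (unitInterval.symm p.1, p.2), hRtU _ _ p.2.2⟩
       continuous_toFun :=
         (hRtc.comp ((unitInterval.continuous_symm.comp continuous_fst).prodMk
           (continuous_subtype_val.comp continuous_snd))).subtype_mk _
       map_zero_left := fun u => Subtype.ext (by
         show Rt (unitInterval.symm 0, u) = Rt (1, u)
         rw [unitInterval.symm_zero])
       map_one_left := fun u => Subtype.ext (by
         show Rt (unitInterval.symm 1, u) = u
         rw [unitInterval.symm_one]
         exact hRt0 u) }⟩
  exact ⟨⟨incl, retr, HL, HR⟩, fun u => rfl⟩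

/-- **`π₁(U) → π₁(W)` is injective for the open slab `U` around the critical values**: two
paths of `U = g⁻¹(ℓ₀, ℓ₁)` (as a subspace) whose images in `W` are homotopic rel end-points are
homotopic rel end-points in `U` — the functor of fundamental groupoids induced by the
inclusion is an equivalence (Mathlib's `FundamentalGroupoidFunctor.equivOfHomotopyEquiv`),
hence faithful. [cite: MilnorHCobordism1965, Thm. 3.4 and Cor. 3.5, used as on PDF p. 56] -/
theorem Cobordism.homotopic_of_homotopic_map_val_openSlab {c : Cobordism n M N} {g : c.W → ℝ}
    (hg : c.IsMorseFunction g) {ℓ₀ ℓ₁ : ℝ} (hℓ₀ : 0 < ℓ₀) (hℓ₀₁ : ℓ₀ < ℓ₁) (hℓ₁ : ℓ₁ < 1)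
    (hcrit : ∀ z ∈ criticalSet (𝓡∂ (n + 1)) g, g z ∈ Ioo ℓ₀ ℓ₁)
    {x y : ↥(g ⁻¹' Ioo ℓ₀ ℓ₁)} (γ γ' : Path x y)
    (h : (γ.map continuous_subtype_val).Homotopic (γ'.map continuous_subtype_val)) :
    γ.Homotopic γ' := by
  haveI : Nonempty c.W := ⟨x.1⟩
  obtain ⟨e, he⟩ := Cobordism.exists_homotopyEquiv_openSlab hg hℓ₀ hℓ₀₁ hℓ₁ hcrit
  -- the induced functor of fundamental groupoids is faithful
  let Φ := FundamentalGroupoidFunctor.equivOfHomotopyEquiv e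
  have himg : Φ.functor.map (X := ⟨x⟩) (Y := ⟨y⟩) ⟦γ⟧ =
      Φ.functor.map (X := ⟨x⟩) (Y := ⟨y⟩) ⟦γ'⟧ := by
    show (FundamentalGroupoid.map e.toFun).map (X := ⟨x⟩) (Y := ⟨y⟩) ⟦γ⟧ =
      (FundamentalGroupoid.map e.toFun).map (X := ⟨x⟩) (Y := ⟨y⟩) ⟦γ'⟧
    simp only [FundamentalGroupoid.map_map, Path.Homotopic.Quotient.mk''_eq_mk,
      ← Path.Homotopic.Quotient.mk_map]
    have hval : ⇑e.toFun = (Subtype.val : ↥(g ⁻¹' Ioo ℓ₀ ℓ₁) → c.W) := funext he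
    have key : ∀ (f : ↥(g ⁻¹' Ioo ℓ₀ ℓ₁) → c.W) (hf : Continuous f), f = Subtype.val →
        (γ.map hf).Homotopic (γ'.map hf) := by
      rintro f hf rfl; exact h
    exact Quotient.sound (key _ e.toFun.continuous hval)
  have hinj := Φ.functor.map_injective (X := ⟨x⟩) (Y := ⟨y⟩) himg
  exact Quotient.exact hinj

end Cobordism

end Literature.Topology.FourManifolds

end
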